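import Literature.MathematicalPhysics.KineticTheory.PrefixRungHostBlock
import Literature.MathematicalPhysics.KineticTheory.CellChainEnergyFlow
import HarnessLib

/-!
# The host-block regime of the prefix cell chain: a definite dissipation `≥ c K⁴` at the RIGHT bath over a window of order one

Trunk T-KINETIC (Literature/MathematicalPhysics/KineticTheory). For the MIXED rung
`cellChain ω₂ lam β γ (· < k)` on `N = k + 1 + n` sites with a nonempty host block (`n ≥ 1`; crux
`PrefixSteadyStates` of `AtomisticToContinuum/FouriersLaw`): along the pathwise solution
`z = drivenFlow Y x (0, η)` at energy scale `K⁴` (`H(x) ≤ 2K⁴`, noise `‖η‖ ≤ δ₀K` on `[0, T]`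
supported on the two bath sites, `A δ₀ K T ≤ K`), if at some time `s₀` the energy is still `≥ K⁴/2`
while the rescaled limit energy of the cell block is `≤ 1/8`, then the HOST block carries `≥ K⁴/4`
(the exact splitting of `PrefixRungEnergyBlocks.lean`, the harmonic cell terms being `O(K²)`), hence
`∑_host (q² + p²) ≳ K⁴`, and the linear observability of the damped harmonic host block with the
interface position `q_k = O(K)` as a bounded forcing (a displayed hypothesis here — the crux stub
`stub_prefixHostObservability`, landed as `DampedHarmonicBlockObservability.lean`) makes the smooth
right-bath momentum dissipate `∫_{s₀}^{s₀+τ} ȳ_{N-1}² ≥ (c₀/(16γ(ω₂/2+4))) K⁴` for `K ≥ K₀`. This is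
the point where no closeness to a limit dynamics is needed: the linear estimate is robust to the
energy exchanged with the cell block during the window.

* `prefixRung_hostRegime_gain` — the statement above.

## References

* N. Cuneo, J.-P. Eckmann, M. Hairer, L. Rey-Bellet, EJP 23 (2018) no. 55, Remark 2.11 (mixed
  degrees) and §5 (the dissipation integral).
* E. D. Sontag, *Mathematical Control Theory* (2nd ed., 1998), §6.2 (observability of linear systems).
-/

noncomputable section

open MeasureTheory Filter Topology Set Metric Function Finset
open scoped NNReal

namespace Literature.MathematicalPhysics.KineticTheory.HeatConduction

open OscillatorChain Literature.Analysis.ODE Literature.MathematicalPhysics.KineticTheory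

section HostGain

/- The limit cell chain of the prefix rung, as a structure literal (notation only, as in
`PrefixRungScaling.lean`). -/
set_option quotPrecheck false in
local notation "P₀⟦" lam ", " β ", " k "⟧" =>
  (SiteChain.mk (fun i q => (if i < k then lam else 0) * q ^ 4 / 4) (fun _ r => β * r ^ 4 / 4) 0)

variable {ω₂ lam β γ : ℝ} {k n : ℕ}

set_option maxHeartbeats 1600000 in
/-- **The host-block regime gains `(c₀/(16γ(ω₂/2+4))) K⁴` at the right bath over a window `τ`.**
Data: the prefix rung with `ω₂, lam, β, γ > 0`, `0 < k`, `n ≥ 1` host sites; a window `τ > 0`, a noise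
size `δ₀ > 0`, a cell level `ε_c ≤ 1/8`, and observability constants `c₀ > 0`, `C₀ ≥ 0` for the
damped harmonic host block over `[0, τ]` (the displayed hypothesis `hS4`). Then there is `K₀ ≥ 1` such
that for `K ≥ K₀`: for every start `x` with `H(x) ≤ 2K⁴`, every continuous noise path `η` supported on
the bath sites with `‖η‖ ≤ δ₀K` on `[0, T]` and `A δ₀ K T ≤ K`, and every `s₀ ≥ 0` with `s₀ + τ ≤ T`
at which `Ĥ₀(π(rescale K z(s₀))) ≤ ε_c` and `H(z(s₀)) ≥ K⁴/2`, the smooth right-bath momentum of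
`z = drivenFlow Y x (0,η)` satisfies `∫_{s₀}^{s₀+τ} ȳ_{N-1}² ≥ (c₀/(16γ(ω₂/2+4))) K⁴`.
[cite: CuneoEckmannHairerReyBellet2018, Rem 2.11] -/
theorem prefixRung_hostRegime_gain (hω : 0 < ω₂) (hl : 0 < lam) (hβ : 0 < β) (hγ : 0 < γ) (hk : 0 < k)
    (hn : 0 < n) {τ δ₀ εc c₀ C₀ : ℝ} (hτ : 0 < τ) (hδ₀ : 0 < δ₀) (hεc : εc ≤ 1 / 8)
    (hc₀ : 0 < c₀) (hC₀ : 0 ≤ C₀)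
    (hS4 : ∀ (Mu Mξ : ℝ) (u ξ : ℝ → ℝ) (X : ℝ → PhaseSpace n),
      Continuous u → Continuous ξ → Continuous X →
      (∀ t ∈ Icc (0 : ℝ) τ, |u t| ≤ Mu) → (∀ t ∈ Icc (0 : ℝ) τ, |ξ t| ≤ Mξ) →
      (∀ t ∈ Icc (0 : ℝ) τ,
        X t = X 0 + ((0 : Fin n → ℝ), fun j : Fin n => if j.val = n - 1 then ξ t else 0) +
          ∫ s in (0 : ℝ)..t,
            ((X s).2, fun j : Fin n =>
              -(ω₂ * (X s).1 j) +
                (if h : j.val + 1 < n then (X s).1 ⟨j.val + 1, h⟩ - (X s).1 j else 0) -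
                (if h : 0 < j.val then (X s).1 j - (X s).1 ⟨j.val - 1, by omega⟩
                  else (X s).1 j - u s) -
                (if j.val = n - 1 then γ * (X s).2 j else 0))) →
      c₀ * (∑ j, ((X 0).1 j ^ 2 + (X 0).2 j ^ 2)) - C₀ * (Mu ^ 2 + Mξ ^ 2) ≤
        γ * ∫ s in (0 : ℝ)..τ, ((X s).2 ⟨n - 1, by omega⟩ - ξ s) ^ 2) :
    ∃ K₀ : ℝ, 1 ≤ K₀ ∧ ∀ K : ℝ, K₀ ≤ K → ∀ (x : PhaseSpace (k + 1 + n)),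
      (cellChain ω₂ lam β γ (fun i => decide (i < k))).hamiltonian (k + 1 + n) x ≤ 2 * K ^ 4 →
      ∀ (η : ℝ → Fin (k + 1 + n) → ℝ) (T : ℝ), Continuous η →
      (∀ t (i : Fin (k + 1 + n)), i.val ≠ 0 → i.val + 1 ≠ k + 1 + n → η t i = 0) →
      (∀ t ∈ Icc 0 T, ‖η t‖ ≤ δ₀ * K) → pinnedChainScaleA γ (k + 1 + n) * (δ₀ * K) * T ≤ K →
      ∀ s₀ : ℝ, 0 ≤ s₀ → s₀ + τ ≤ T →
      P₀⟦lam, β, k⟧.hamiltonian (k + 1) (prefixRungProj k (k + 1 + n) (Nat.le_add_right _ _)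
        (rescale K (drivenFlow ((cellChain ω₂ lam β γ (fun i => decide (i < k))).langevinDrift (k + 1 + n)) x
          (fun s => ((0 : Fin (k + 1 + n) → ℝ), η s)) s₀))) ≤ εc →
      K ^ 4 / 2 ≤ (cellChain ω₂ lam β γ (fun i => decide (i < k))).hamiltonian (k + 1 + n)
        (drivenFlow ((cellChain ω₂ lam β γ (fun i => decide (i < k))).langevinDrift (k + 1 + n)) x
          (fun s => ((0 : Fin (k + 1 + n) → ℝ), η s)) s₀) →
      c₀ / (16 * γ * (ω₂ / 2 + 4)) * K ^ 4 ≤ ∫ t in s₀..s₀ + τ,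
        (drivenFlow ((cellChain ω₂ lam β γ (fun i => decide (i < k))).langevinDrift (k + 1 + n)) x
            (fun s => ((0 : Fin (k + 1 + n) → ℝ), η s)) t - ((0 : Fin (k + 1 + n) → ℝ), η t)).2
          (Fin.natAdd (k + 1) ⟨n - 1, by omega⟩) ^ 2 := by
  set N := k + 1 + n with hNdef
  set P := cellChain ω₂ lam β γ (fun i => decide (i < k)) with hP
  have hUC := cellChain_uniformlyConfining hω hl.le hβ.le hγ.le (fun i => decide (i < k))
  have hkN : k + 1 ≤ N := Nat.le_add_right _ _
  set c₁ := pinnedChainScaleC ω₂ lam β γ N with hc₁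
  have hc₁0 : 0 ≤ c₁ := pinnedChainScaleC_nonneg hω.le hl.le hβ.le hγ.le N
  -- the constants
  set Cq : ℝ := 2 * (max 1 (4 * c₁ / lam) + max 1 (4 * c₁ / β)) with hCq
  have hCq0 : 0 ≤ Cq := by
    have := le_max_left 1 (4 * c₁ / lam); have := le_max_left 1 (4 * c₁ / β); rw [hCq]; linarith
  set D : ℝ := ω₂ / 2 + 4 with hD
  have hD0 : 0 < D := by rw [hD]; positivity
  set Ch : ℝ := (k + 1) * (ω₂ / 2 + 2) * Cq ^ 2 with hCh
  have hCh0 : 0 ≤ Ch := by rw [hCh]; positivity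
  -- the lower-order coefficient and the threshold
  set E : ℝ := c₀ * (Ch + Cq ^ 2) / D + C₀ * (Cq ^ 2 + 4 * δ₀ ^ 2) + 2 * γ * τ * δ₀ ^ 2 with hE
  have hE0 : 0 ≤ E := by rw [hE]; positivity
  set K₀ : ℝ := max 1 (16 * D * E / c₀ + 1) with hK₀
  refine ⟨K₀, le_max_left _ _, ?_⟩
  intro K hK x hx η T hη hsupp hM hAMT s₀ hs₀ hsT hcell hhigh
  have hK1 : 1 ≤ K := (le_max_left _ _).trans hK
  have hK0 : 0 < K := by linarith
  have hKE : 16 * D * E / c₀ ≤ K := by have := (le_max_right _ _).trans hK; linarith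
  have hT0 : 0 ≤ T := by linarith
  have hs₀T : s₀ ∈ Icc 0 T := ⟨hs₀, by linarith⟩
  -- the path, its integral equation, the ceiling
  set Y := P.langevinDrift N with hY
  set z : ℝ → PhaseSpace N := drivenFlow Y x (fun s => ((0 : Fin N → ℝ), η s)) with hz
  have hzc : Continuous z := hUC.continuous_drivenFlow N x hη
  have hzIE := hUC.isIntegralSolutionOn_drivenFlow N x hη T
  have hceil : ∀ t ∈ Icc 0 T, P.hamiltonian N (z t - ((0 : Fin N → ℝ), η t)) ≤ c₁ * K ^ 4 :=
    cellChain_hamiltonian_smoothPart_le_ceiling hω hl.le hβ.le hγ.le (fun i => decide (i < k)) N hK1 hx hzc hM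
      hAMT hzIE
  -- cell positions are `O(K)` along `[0, T]` (positions of `z` = positions of the smooth part)
  have hq : ∀ t ∈ Icc 0 T, ∀ i : Fin N, i.val ≤ k → |(z t).1 i| ≤ Cq * K := by
    intro t ht i hi
    have e : (z t).1 i = (z t - ((0 : Fin N → ℝ), η t)).1 i := by simp
    rw [e]
    exact prefixRung_abs_fst_le_of_hamiltonian_le hω.le hl hβ hk hK0 _ (hceil t ht) i hi
  -- the host integral equation restarted at `s₀`, and the stub hypothesis
  have hIE := prefixRung_host_integralEq (ω₂ := ω₂) (lam := lam) (β := β) (γ := γ) (k := k) (n := n) hω hl.le hβ.le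
    hγ.le hn hzIE hzc hsupp hs₀T
  set L : Fin N := Fin.natAdd (k + 1) ⟨n - 1, by omega⟩ with hL
  set X : ℝ → PhaseSpace n := fun t => prefixHostProj k n (z (s₀ + t)) with hX
  set u : ℝ → ℝ := fun s => (z (s₀ + s)).1 (Fin.castAdd n (Fin.last k)) with hu
  set ξ : ℝ → ℝ := fun t => η (s₀ + t) L - η s₀ L with hξ
  have hXc : Continuous X := (prefixHostProj k n).continuous.comp (hzc.comp (continuous_const.add continuous_id))
  have huc : Continuous u :=
    (continuous_apply _).comp (continuous_fst.comp (hzc.comp (continuous_const.add continuous_id)))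
  have hξc : Continuous ξ :=
    ((continuous_apply L).comp (hη.comp (continuous_const.add continuous_id))).sub continuous_const
  have hMu : ∀ t ∈ Icc (0 : ℝ) τ, |u t| ≤ Cq * K := fun t ht =>
    hq (s₀ + t) ⟨by linarith [ht.1], by linarith [ht.2]⟩ _ (by simp)
  have hηL : ∀ t ∈ Icc 0 T, |η t L| ≤ δ₀ * K := fun t ht =>
    (Real.norm_eq_abs _ ▸ norm_le_pi_norm (η t) L).trans (hM t ht)
  have hMξ : ∀ t ∈ Icc (0 : ℝ) τ, |ξ t| ≤ 2 * δ₀ * K := by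
    intro t ht
    have h1 := hηL (s₀ + t) ⟨by linarith [ht.1], by linarith [ht.2]⟩
    have h2 := hηL s₀ hs₀T
    calc |ξ t| = |η (s₀ + t) L - η s₀ L| := rfl
      _ ≤ |η (s₀ + t) L| + |η s₀ L| := abs_sub _ _
      _ ≤ 2 * δ₀ * K := by linarith
  have hXIE : ∀ t ∈ Icc (0 : ℝ) τ,
      X t = X 0 + ((0 : Fin n → ℝ), fun j : Fin n => if j.val = n - 1 then ξ t else 0) +
        ∫ s in (0 : ℝ)..t,
          ((X s).2, fun j : Fin n =>
            -(ω₂ * (X s).1 j) +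
              (if h : j.val + 1 < n then (X s).1 ⟨j.val + 1, h⟩ - (X s).1 j else 0) -
              (if h : 0 < j.val then (X s).1 j - (X s).1 ⟨j.val - 1, by omega⟩
                else (X s).1 j - u s) -
              (if j.val = n - 1 then γ * (X s).2 j else 0)) := fun t ht =>
    hIE t ⟨ht.1, by linarith [ht.2]⟩
  have hobs := hS4 (Cq * K) (2 * δ₀ * K) u ξ X huc hξc hXc hMu hMξ hXIE
  -- the host block carries `≥ (3/8)K⁴ - O(K²)`
  have hsplit := prefixRung_hamiltonian_split (ω₂ := ω₂) (lam := lam) (β := β) (γ := γ) (k := k) (n := n)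
    hK0.ne' hkN (z s₀)
  have hharm : prefixCellHarm ω₂ k n (z s₀) ≤ Ch * K ^ 2 := by
    have h := prefixCellHarm_le (ω₂ := ω₂) (k := k) (n := n) hω.le (K := K) (Cq := Cq) (z s₀)
      (fun i => hq s₀ hs₀T (Fin.castAdd n i) (by simp; omega))
    rw [hCh]; linarith
  have hhostE : K ^ 4 / 4 - Ch * K ^ 2 ≤ prefixHostEnergy ω₂ k n (z s₀) := by
    have hK4 : 0 ≤ K ^ 4 := by positivity
    have h1 : K ^ 4 * P₀⟦lam, β, k⟧.hamiltonian (k + 1) (prefixRungProj k N hkN (rescale K (z s₀))) ≤ K ^ 4 * (1 / 8) :=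
      mul_le_mul_of_nonneg_left (hcell.trans hεc) hK4
    linarith [hsplit, hhigh, h1, hharm]
  have hsum : K ^ 4 / 4 - (Ch + Cq ^ 2) * K ^ 2 ≤ D * ∑ j : Fin n, ((X 0).1 j ^ 2 + (X 0).2 j ^ 2) := by
    have h := prefixHostEnergy_le_sum_sq (ω₂ := ω₂) (k := k) (n := n) hω.le (z s₀)
    have hqk : (z s₀).1 (Fin.castAdd n (Fin.last k)) ^ 2 ≤ (Cq * K) ^ 2 := by
      have := hq s₀ hs₀T (Fin.castAdd n (Fin.last k)) (by simp)
      rw [← sq_abs]; exact pow_le_pow_left₀ (abs_nonneg _) this 2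
    have e : ∑ j : Fin n, ((X 0).1 j ^ 2 + (X 0).2 j ^ 2) =
        ∑ j : Fin n, ((z s₀).1 (Fin.natAdd (k + 1) j) ^ 2 + (z s₀).2 (Fin.natAdd (k + 1) j) ^ 2) := by
      simp [hX]
    rw [e, hD]
    nlinarith [hhostE, h, hqk]
  -- the stub's conclusion, with the lower-order terms collected
  have hobs' : c₀ / D * (K ^ 4 / 4) - (c₀ * (Ch + Cq ^ 2) / D + C₀ * (Cq ^ 2 + 4 * δ₀ ^ 2)) * K ^ 2 ≤
      γ * ∫ s in (0 : ℝ)..τ, ((X s).2 ⟨n - 1, by omega⟩ - ξ s) ^ 2 := by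
    have h1 : c₀ / D * (K ^ 4 / 4 - (Ch + Cq ^ 2) * K ^ 2) ≤ c₀ * ∑ j : Fin n, ((X 0).1 j ^ 2 + (X 0).2 j ^ 2) := by
      rw [div_mul_eq_mul_div, div_le_iff₀ hD0]
      nlinarith [hsum, hc₀.le]
    have h2 : C₀ * ((Cq * K) ^ 2 + (2 * δ₀ * K) ^ 2) = C₀ * (Cq ^ 2 + 4 * δ₀ ^ 2) * K ^ 2 := by ring
    have h3 : c₀ / D * (K ^ 4 / 4 - (Ch + Cq ^ 2) * K ^ 2) = c₀ / D * (K ^ 4 / 4) - c₀ * (Ch + Cq ^ 2) / D * K ^ 2 := by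
      ring
    linarith [hobs, h1, h2, h3]
  -- back to the smooth right-bath momentum: `(X s).2_{n-1} - ξ s = ȳ_L(s₀+s) + η_L(s₀)`
  set a : ℝ → ℝ := fun s => (z (s₀ + s) - ((0 : Fin N → ℝ), η (s₀ + s))).2 L with ha'
  set e : ℝ := η s₀ L with he
  have hae : ∀ s, (X s).2 ⟨n - 1, by omega⟩ - ξ s = a s + e := by
    intro s
    simp only [hX, hξ, ha', he, prefixHostProj_snd, Prod.snd_sub, Pi.sub_apply, hL]
    ring
  have hac : Continuous a :=
    (continuous_apply L).comp (continuous_snd.comp ((hzc.comp (continuous_const.add continuous_id)).sub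
      (continuous_const.prodMk (hη.comp (continuous_const.add continuous_id)))))
  have hint1 : ∫ s in (0 : ℝ)..τ, ((X s).2 ⟨n - 1, by omega⟩ - ξ s) ^ 2 = ∫ s in (0 : ℝ)..τ, (a s + e) ^ 2 :=
    intervalIntegral.integral_congr fun s _ => by simp only [hae s]
  rw [hint1] at hobs'
  -- `∫_{s₀}^{s₀+τ} ȳ_L² = ∫₀^τ a²`
  have hshiftInt : ∫ t in s₀..s₀ + τ, (z t - ((0 : Fin N → ℝ), η t)).2 L ^ 2 = ∫ s in (0 : ℝ)..τ, a s ^ 2 := by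
    rw [intervalIntegral.integral_comp_add_left (fun t => (z t - ((0 : Fin N → ℝ), η t)).2 L ^ 2) s₀]
    simp
  rw [hshiftInt]
  -- `(a+e)² ≤ 2a² + 2e²`, integrate
  have hI : ∫ s in (0 : ℝ)..τ, (a s + e) ^ 2 ≤ ∫ s in (0 : ℝ)..τ, (2 * a s ^ 2 + 2 * e ^ 2) :=
    intervalIntegral.integral_mono_on hτ.le (((hac.add continuous_const).pow 2).intervalIntegrable _ _)
      ((((hac.pow 2).const_mul 2).add continuous_const).intervalIntegrable _ _)
      fun s _ => by nlinarith [sq_nonneg (a s - e)]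
  have hA' : ∫ s in (0 : ℝ)..τ, (2 * a s ^ 2 + 2 * e ^ 2) = (∫ s in (0 : ℝ)..τ, 2 * a s ^ 2) + ∫ _s in (0 : ℝ)..τ, 2 * e ^ 2 :=
    intervalIntegral.integral_add (((hac.pow 2).const_mul 2).intervalIntegrable _ _)
      (continuous_const.intervalIntegrable _ _)
  have hB' : ∫ s in (0 : ℝ)..τ, 2 * a s ^ 2 = 2 * ∫ s in (0 : ℝ)..τ, a s ^ 2 := intervalIntegral.integral_const_mul 2 _
  have hC' : ∫ _s in (0 : ℝ)..τ, 2 * e ^ 2 = τ * (2 * e ^ 2) := by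
    rw [intervalIntegral.integral_const, sub_zero, smul_eq_mul]
  rw [hA', hB', hC'] at hI
  have he2 : e ^ 2 ≤ (δ₀ * K) ^ 2 := by
    rw [he, ← sq_abs]; exact pow_le_pow_left₀ (abs_nonneg _) (hηL s₀ hs₀T) 2
  -- collect: `γ ∫ a² ≥ (c₀/D) K⁴/8 - (E/1) K²·…`, then use `K ≥ 8DE/c₀`
  have hmain : c₀ / D * (K ^ 4 / 8) - E * K ^ 2 ≤ γ * ∫ s in (0 : ℝ)..τ, a s ^ 2 := by
    have h1 : γ * ∫ s in (0 : ℝ)..τ, (a s + e) ^ 2 ≤ 2 * (γ * ∫ s in (0 : ℝ)..τ, a s ^ 2) + γ * (τ * (2 * e ^ 2)) := by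
      have h1a := mul_le_mul_of_nonneg_left hI hγ.le
      have e1a : γ * (2 * (∫ s in (0 : ℝ)..τ, a s ^ 2) + τ * (2 * e ^ 2)) =
          2 * (γ * ∫ s in (0 : ℝ)..τ, a s ^ 2) + γ * (τ * (2 * e ^ 2)) := by ring
      linarith only [h1a, e1a]
    have h2 : γ * (τ * (2 * e ^ 2)) ≤ 2 * γ * τ * δ₀ ^ 2 * K ^ 2 := by
      have h5 := mul_le_mul_of_nonneg_left he2 (by positivity : (0 : ℝ) ≤ γ * τ * 2)
      have e5 : γ * (τ * (2 * e ^ 2)) = γ * τ * 2 * e ^ 2 := by ring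
      have e6 : 2 * γ * τ * δ₀ ^ 2 * K ^ 2 = γ * τ * 2 * (δ₀ * K) ^ 2 := by ring
      rw [e5, e6]; exact h5
    have e7 : E * K ^ 2 = (c₀ * (Ch + Cq ^ 2) / D + C₀ * (Cq ^ 2 + 4 * δ₀ ^ 2)) * K ^ 2 + 2 * γ * τ * δ₀ ^ 2 * K ^ 2 := by
      rw [hE]; ring
    rw [e7]
    have hEK : 0 ≤ (c₀ * (Ch + Cq ^ 2) / D + C₀ * (Cq ^ 2 + 4 * δ₀ ^ 2)) * K ^ 2 + 2 * γ * τ * δ₀ ^ 2 * K ^ 2 := by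
      rw [← e7]; positivity
    linarith only [hobs', h1, h2, hEK]
  -- `E K² ≤ (c₀/D) K⁴/16` since `K ≥ 16 D E / c₀` and `K ≥ 1`
  have hfinal : E * K ^ 2 ≤ c₀ / D * (K ^ 4 / 16) := by
    have h1 : 16 * D * E ≤ c₀ * K := by
      have := mul_le_mul_of_nonneg_left hKE hc₀.le
      rwa [mul_div_cancel₀ _ hc₀.ne'] at this
    have hK2 : 0 ≤ K ^ 2 := by positivity
    have h2 : 16 * D * E * K ^ 2 ≤ c₀ * K * K ^ 2 := mul_le_mul_of_nonneg_right h1 hK2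
    have h3 : c₀ * K * K ^ 2 ≤ c₀ * K ^ 4 := by
      have hK34 : K * K ^ 2 ≤ K ^ 4 := by
        have h5 : K ^ 3 ≤ K ^ 4 := pow_le_pow_right₀ hK1 (by norm_num)
        have e3 : K * K ^ 2 = K ^ 3 := by ring
        rw [e3]; exact h5
      have h6 := mul_le_mul_of_nonneg_left hK34 hc₀.le
      have e4 : c₀ * K * K ^ 2 = c₀ * (K * K ^ 2) := by ring
      rw [e4]; exact h6
    have h4 : 16 * D * E * K ^ 2 ≤ c₀ * K ^ 4 := h2.trans h3
    have e1 : c₀ / D * (K ^ 4 / 16) = c₀ * K ^ 4 / (16 * D) := by field_simp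
    rw [e1, le_div_iff₀ (by positivity)]
    linarith only [h4]
  have hγD : c₀ / (16 * γ * (ω₂ / 2 + 4)) * K ^ 4 = (c₀ / D * (K ^ 4 / 8) - c₀ / D * (K ^ 4 / 16)) / γ := by
    rw [hD]; field_simp; ring
  rw [hγD, div_le_iff₀ hγ]
  have hcomm : (∫ s in (0 : ℝ)..τ, a s ^ 2) * γ = γ * ∫ s in (0 : ℝ)..τ, a s ^ 2 := mul_comm _ _
  linarith only [hmain, hfinal, hcomm]

end HostGain

end Literature.MathematicalPhysics.KineticTheory.HeatConduction
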